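import Mathlib
import Literature.Barriers.ValiantsHypothesis.AlgebraicNaturalProofs
import Literature.Computability.AlgebraicComplexity.ArithCircuitProofs
import Literature.Computability.AlgebraicComplexity.ST21FormulaComplexityBounds
import Summits.ValiantsHypothesis.ValiantsHypothesis.Theorems.BarrierLeverSuccinctHittingSetsForVPSps2
import Summits.ValiantsHypothesis.ValiantsHypothesis.Theorems.BarrierLeverSuccinctHittingSetsForVPStubFullSupport
import HarnessLib

/-!
# Crux `BarrierLever.SuccinctHittingSetsForVP` (stmt-ValiantsHypothesis-14610) — `ΣΠΣ(2)`
# DISTINGUISHERS ARE HIT ALREADY BY `SmallCircuits ℂ n 2` (the wave-7 row at exponent `2`;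
# val-np-p5 g16)

`…Sps2.lean` (wave 7): the two-seed separable generator `Γ₂ μ = Σ_{r<2} y_r s_r^μ` is annihilated by
no nonzero `a ∏ ℓ_i + b ∏ ℓ'_j` (non-constant affine forms `ℓ_i, ℓ'_j` of the `N = C(2n,n)`
coefficient variables; `stub_sps2NotAnnihilated stub_affineFormIrreducible`), and is realised inside
`coeff(SmallCircuits ℂ n 9)` through the GENERAL separable-coefficient circuits of
`stub_separableCoeff` (size `≤ n⁸`: degree truncation of a product of arbitrary univariates) — hence
exponent `9`.  For the GEOMETRIC coefficient sequences that `Γ₂` actually needs there is a far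
cheaper realisation: the WEIGHTED generator `Γ₂' μ = α_μ · Γ₂ μ`, `α_μ = coeff_μ (1 + Σ x_i)^n ≠ 0`
(a multinomial coefficient), is realised by `Σ_r y_r (1 + Σ_i s_{r,i} x_i)^n` — two `n`-th powers of
affine forms, size `≤ 6n + 6 ≤ n²` — and a distinguisher annihilates `Γ₂'` iff its RESCALING
`D(α_μ c_μ)` annihilates `Γ₂`; rescaling by nonzero scalars maps the class `ΣΠΣ(2)` to itself.

* `isSuccinctHittingSet_sps2_two` — for `n ≥ 7`, `SmallCircuits ℂ n 2` hits every nonzero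
  `a ∏ ℓ_i + b ∏ ℓ'_j` (tree: `SmallCircuits ℂ n 9`, `n ≥ 8`); `isSuccinctHittingSet_sps2_of_two_le`
  for every `b ≥ 2`;
* `not_isNaturalProof_sps2_two` — no such polynomial is a natural proof against size `n^b`, `b ≥ 2`;
* `isSuccinctHittingSet_prodAffine_two`, `isSuccinctHittingSet_twoByTwoAffine_two` — products of
  affine forms and `2 × 2` determinants of affine forms are hit at exponent `2`.

WHAT THIS IS NOT: nothing on `ΣΠΣ(k)`, `k ≥ 3`, on the dense heart of the crux, or on `VP ≠ VNP`.
No definitions, no named facts; standard axioms.  Refs: [ForbesShpilkaVolk2018] §3 (generators),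
Construction 25, Question 6; Dvir–Shpilka 2007 / Saxena–Seshadhri 2011 (`ΣΠΣ(2)` identities);
Bürgisser 2000 §2.1.
-/

-- layout Summits/ValiantsHypothesis/ValiantsHypothesis forces the duplicated namespace component
set_option linter.dupNamespace false

noncomputable section

namespace Summit.ValiantsHypothesis.ValiantsHypothesis.Theorems.BarrierLever.SuccinctHittingSetsForVP

open Literature.Barriers.ValiantsHypothesis Literature.Computability.AlgebraicComplexity MvPolynomial

namespace Sps2Two

/-! ## §1 Rescaling variables by nonzero scalars -/

section Rescale

variable {σ : Type*}

/-- Coefficients under the rescaling `x_v ↦ α_v x_v`: `coeff_m p(α x) = (∏_{v} α_v^{m_v}) coeff_m p`.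
[folklore] -/
theorem coeff_aeval_scale (α : σ → ℂ) (p : MvPolynomial σ ℂ) (m : σ →₀ ℕ) :
    coeff m (aeval (fun v => C (α v) * X v) p) = (∏ v ∈ m.support, α v ^ m v) * coeff m p := by
  classical
  induction p using MvPolynomial.induction_on' with
  | monomial u a =>
    have hmono : aeval (fun v => C (α v) * X v) (monomial u a) =
        monomial u (a * ∏ v ∈ u.support, α v ^ u v) := by
      rw [aeval_monomial, Finsupp.prod, Algebra.algebraMap_eq_smul_one]
      simp_rw [mul_pow, ← map_pow]
      rw [Finset.prod_mul_distrib, ← map_prod, prod_X_pow_eq_monomial, smul_mul_assoc, one_mul,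
        C_mul_monomial, smul_monomial, smul_eq_mul, mul_one, mul_comm]
    rw [hmono, coeff_monomial, coeff_monomial]
    split_ifs with h
    · subst h; ring
    · rw [mul_zero]
  | add p q hp hq => rw [map_add, coeff_add, coeff_add, hp, hq, mul_add]

/-- Rescaling by NONZERO scalars preserves the support. [folklore] -/
theorem support_aeval_scale {α : σ → ℂ} (hα : ∀ v, α v ≠ 0) (p : MvPolynomial σ ℂ) :
    (aeval (fun v => C (α v) * X v) p).support = p.support := by
  classical
  ext m
  rw [mem_support_iff, mem_support_iff, coeff_aeval_scale]
  have hprod : (∏ v ∈ m.support, α v ^ m v) ≠ 0 :=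
    Finset.prod_ne_zero_iff.mpr fun v _ => pow_ne_zero _ (hα v)
  exact (mul_ne_zero_iff.trans (and_iff_right hprod))

/-- Rescaling by nonzero scalars preserves the total degree. [folklore] -/
theorem totalDegree_aeval_scale {α : σ → ℂ} (hα : ∀ v, α v ≠ 0) (p : MvPolynomial σ ℂ) :
    (aeval (fun v => C (α v) * X v) p).totalDegree = p.totalDegree := by
  simp only [MvPolynomial.totalDegree, support_aeval_scale hα]

/-- Rescaling by nonzero scalars is injective on `≠ 0`. [folklore] -/
theorem aeval_scale_ne_zero {α : σ → ℂ} (hα : ∀ v, α v ≠ 0) {p : MvPolynomial σ ℂ} (hp : p ≠ 0) :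
    aeval (fun v => C (α v) * X v) p ≠ 0 := by
  intro h
  apply hp
  rw [← support_eq_empty, ← support_aeval_scale hα p, h, support_zero]

end Rescale

/-! ## §2 The weighted two-seed generator and its non-annihilation -/

variable {n : ℕ}

/-- The multinomial weights `α_μ = coeff_μ (1 + Σ_i x_i)^n` (nonzero on `degLEMonomials n`).
[cite: ForbesShpilkaVolk2018, Construction 29] -/
theorem weight_ne_zero (μ : degLEMonomials n) :
    coeff (μ : Fin n →₀ ℕ) ((1 + ∑ i : Fin n, X i : MvPolynomial (Fin n) ℂ) ^ n) ≠ 0 :=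
  FullSupport.coeff_linearForm_pow_ne_zero (n := n) n (μ : Fin n →₀ ℕ) μ.2

/-- **The weighted generator is not annihilated by `ΣΠΣ(2)`.**  With
`α_μ = coeff_μ (1 + Σ x_i)^n`, no nonzero `a ∏ ℓ_i + b ∏ ℓ'_j` (affine forms of total degree `1`)
annihilates `μ ↦ α_μ · Σ_{r<2} y_r ∏_i s_{r,i}^{μ_i}`: composing with the weights is the rescaling
`c_μ ↦ α_μ c_μ`, which maps the class to itself, and `Γ₂` itself is not annihilated
(`stub_sps2NotAnnihilated stub_affineFormIrreducible`). [cite: ForbesShpilkaVolk2018, §3] -/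
theorem weighted_not_annihilated {p q : ℕ} (a b : ℂ)
    (ℓ : Fin p → MvPolynomial (degLEMonomials n) ℂ) (ℓ' : Fin q → MvPolynomial (degLEMonomials n) ℂ)
    (hℓ : ∀ i, (ℓ i).totalDegree = 1) (hℓ' : ∀ j, (ℓ' j).totalDegree = 1)
    (hD : C a * ∏ i, ℓ i + C b * ∏ j, ℓ' j ≠ 0) :
    aeval (fun μ : degLEMonomials n =>
        C (coeff (μ : Fin n →₀ ℕ) ((1 + ∑ i : Fin n, X i : MvPolynomial (Fin n) ℂ) ^ n)) *
          ∑ r : Fin 2, (X (Sum.inl r) : MvPolynomial (Fin 2 ⊕ (Fin 2 × Fin n)) ℂ) *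
            ∏ i : Fin n, X (Sum.inr (r, i)) ^ (μ : Fin n →₀ ℕ) i)
      (C a * ∏ i, ℓ i + C b * ∏ j, ℓ' j) ≠ 0 := by
  set α : degLEMonomials n → ℂ :=
    fun μ => coeff (μ : Fin n →₀ ℕ) ((1 + ∑ i : Fin n, X i : MvPolynomial (Fin n) ℂ) ^ n) with hα
  have hα0 : ∀ μ, α μ ≠ 0 := fun μ => weight_ne_zero μ
  set Γ : degLEMonomials n → MvPolynomial (Fin 2 ⊕ (Fin 2 × Fin n)) ℂ :=
    fun μ => ∑ r : Fin 2, (X (Sum.inl r) : MvPolynomial (Fin 2 ⊕ (Fin 2 × Fin n)) ℂ) *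
      ∏ i : Fin n, X (Sum.inr (r, i)) ^ (μ : Fin n →₀ ℕ) i with hΓ
  -- the weighted generator is `Γ` after the rescaling `c_μ ↦ α_μ c_μ`
  have hcomp : (aeval fun μ : degLEMonomials n => C (α μ) * Γ μ) =
      (aeval Γ).comp (aeval fun μ : degLEMonomials n =>
        C (α μ) * (X μ : MvPolynomial (degLEMonomials n) ℂ)) := by
    rw [comp_aeval]
    congr 1
    funext μ
    rw [map_mul, algHom_C, aeval_X, MvPolynomial.algebraMap_eq]
  show (aeval fun μ : degLEMonomials n => C (α μ) * Γ μ) (C a * ∏ i, ℓ i + C b * ∏ j, ℓ' j) ≠ 0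
  rw [hcomp, AlgHom.comp_apply]
  -- the rescaled distinguisher is again `ΣΠΣ(2)` with degree-one forms, and nonzero
  have hresc : aeval (fun μ : degLEMonomials n => C (α μ) * (X μ : MvPolynomial (degLEMonomials n) ℂ))
      (C a * ∏ i, ℓ i + C b * ∏ j, ℓ' j) =
      C a * ∏ i, aeval (fun μ : degLEMonomials n => C (α μ) * X μ) (ℓ i) +
        C b * ∏ j, aeval (fun μ : degLEMonomials n => C (α μ) * X μ) (ℓ' j) := by
    simp only [map_add, map_mul, map_prod, algHom_C, MvPolynomial.algebraMap_eq]
  rw [hresc]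
  refine stub_sps2NotAnnihilated stub_affineFormIrreducible n p q a b _ _
    (fun i => by rw [totalDegree_aeval_scale hα0]; exact hℓ i)
    (fun j => by rw [totalDegree_aeval_scale hα0]; exact hℓ' j) ?_
  rw [← hresc]
  exact aeval_scale_ne_zero hα0 hD

/-! ## §3 Realisation of the weighted generator inside `SmallCircuits ℂ n 2` -/

/-- The scaled power of the affine form: `(1 + Σ_i s_i x_i)^n = ((1 + Σ_i x_i)^n)(s x)`. [folklore] -/
theorem scaledPow_eq_aeval (s : Fin n → ℂ) :
    ((1 + ∑ i : Fin n, C (s i) * X i : MvPolynomial (Fin n) ℂ) ^ n) =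
      aeval (fun i => C (s i) * X i) ((1 + ∑ i : Fin n, X i : MvPolynomial (Fin n) ℂ) ^ n) := by
  simp only [map_pow, map_add, map_one, map_sum, aeval_X]

/-- Its coefficients: `coeff_μ (1 + Σ s_i x_i)^n = (∏_i s_i^{μ_i}) · α_μ`. [folklore] -/
theorem coeff_scaledPow (s : Fin n → ℂ) (μ : degLEMonomials n) :
    coeff (μ : Fin n →₀ ℕ) ((1 + ∑ i : Fin n, C (s i) * X i : MvPolynomial (Fin n) ℂ) ^ n) =
      (∏ i : Fin n, s i ^ (μ : Fin n →₀ ℕ) i) *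
        coeff (μ : Fin n →₀ ℕ) ((1 + ∑ i : Fin n, X i : MvPolynomial (Fin n) ℂ) ^ n) := by
  classical
  rw [scaledPow_eq_aeval, coeff_aeval_scale]
  congr 1
  exact Finset.prod_subset (Finset.subset_univ _) fun i _ hi => by
    rw [Finsupp.notMem_support_iff.mp hi, pow_zero]

/-- Size of the scaled power: `L((1 + Σ s_i x_i)^n) ≤ 3n + 1`. [cite: Burgisser2000, §2.1] -/
theorem complexity_scaledPow_le (s : Fin n → ℂ) :
    complexity ((1 + ∑ i : Fin n, C (s i) * X i : MvPolynomial (Fin n) ℂ) ^ n) ≤ 3 * n + 1 := by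
  have h1 : complexity (1 : MvPolynomial (Fin n) ℂ) = 0 := by
    simpa using complexity_C_holds (σ := Fin n) (1 : ℂ)
  have hterm : ∀ i : Fin n, complexity (C (s i) * X i : MvPolynomial (Fin n) ℂ) ≤ 1 := fun i => by
    have h := complexity_mul_le_holds (C (s i) : MvPolynomial (Fin n) ℂ) (X i)
    rw [complexity_C_holds, complexity_X_holds] at h
    omega
  have hsum : complexity (∑ i : Fin n, C (s i) * X i : MvPolynomial (Fin n) ℂ) ≤ 2 * n := by
    refine (complexity_finset_sum_le _ _).trans ?_
    calc ∑ i : Fin n, complexity (C (s i) * X i : MvPolynomial (Fin n) ℂ) +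
          (Finset.univ : Finset (Fin n)).card
        ≤ ∑ _i : Fin n, 1 + (Finset.univ : Finset (Fin n)).card := by gcongr with i; exact hterm i
      _ = 2 * n := by simp; ring
  have haff : complexity (1 + ∑ i : Fin n, C (s i) * X i : MvPolynomial (Fin n) ℂ) ≤ 2 * n + 1 := by
    have h := complexity_add_le_holds (1 : MvPolynomial (Fin n) ℂ) (∑ i : Fin n, C (s i) * X i)
    rw [h1] at h
    omega
  calc complexity ((1 + ∑ i : Fin n, C (s i) * X i : MvPolynomial (Fin n) ℂ) ^ n)
      ≤ complexity (1 + ∑ i : Fin n, C (s i) * X i : MvPolynomial (Fin n) ℂ) + n :=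
        SahaThankey2021.complexity_pow_le _ _
    _ ≤ 3 * n + 1 := by omega

/-- Degree of the scaled power: `≤ n`. [folklore] -/
theorem totalDegree_scaledPow_le (s : Fin n → ℂ) :
    ((1 + ∑ i : Fin n, C (s i) * X i : MvPolynomial (Fin n) ℂ) ^ n).totalDegree ≤ n := by
  refine (totalDegree_pow _ _).trans ?_
  have haff : (1 + ∑ i : Fin n, C (s i) * X i : MvPolynomial (Fin n) ℂ).totalDegree ≤ 1 := by
    refine (totalDegree_add _ _).trans (max_le (by rw [totalDegree_one]; exact Nat.zero_le _) ?_)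
    refine totalDegree_finsetSum_le fun i _ => (totalDegree_mul _ _).trans ?_
    rw [totalDegree_C, totalDegree_X, zero_add]
  calc n * (1 + ∑ i : Fin n, C (s i) * X i : MvPolynomial (Fin n) ℂ).totalDegree ≤ n * 1 :=
        Nat.mul_le_mul_left n haff
    _ = n := mul_one n

/-- **Realisability of the weighted generator in `SmallCircuits ℂ n 2` (`n ≥ 7`).**  Every value of
`Γ₂'` at a seed point `(y, s)` is the coefficient vector of `Σ_r y_r (1 + Σ_i s_{r,i} x_i)^n`, of
degree `≤ n` and size `≤ 6n + 6 ≤ n²`. [cite: ForbesShpilkaVolk2018, §3] -/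
theorem realisable_two (hn : 7 ≤ n) (pt : Fin 2 ⊕ (Fin 2 × Fin n) → ℂ) :
    ∃ f ∈ SmallCircuits ℂ n 2, ∀ μ : degLEMonomials n,
      coeff (μ : Fin n →₀ ℕ) f =
        eval pt (C (coeff (μ : Fin n →₀ ℕ) ((1 + ∑ i : Fin n, X i : MvPolynomial (Fin n) ℂ) ^ n)) *
          ∑ r : Fin 2, (X (Sum.inl r) : MvPolynomial (Fin 2 ⊕ (Fin 2 × Fin n)) ℂ) *
            ∏ i : Fin n, X (Sum.inr (r, i)) ^ (μ : Fin n →₀ ℕ) i) := by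
  set Λ : Fin 2 → MvPolynomial (Fin n) ℂ :=
    fun r => (1 + ∑ i : Fin n, C (pt (Sum.inr (r, i))) * X i) ^ n with hΛ
  refine ⟨∑ r : Fin 2, C (pt (Sum.inl r)) * Λ r, ⟨?_, ?_⟩, fun μ => ?_⟩
  · refine totalDegree_finsetSum_le fun r _ => (totalDegree_mul _ _).trans ?_
    rw [totalDegree_C, zero_add]
    exact totalDegree_scaledPow_le _
  · calc complexity (∑ r : Fin 2, C (pt (Sum.inl r)) * Λ r)
        ≤ ∑ r : Fin 2, complexity (C (pt (Sum.inl r)) * Λ r) + (Finset.univ : Finset (Fin 2)).card :=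
          complexity_finset_sum_le _ _
      _ ≤ ∑ _r : Fin 2, (3 * n + 2) + (Finset.univ : Finset (Fin 2)).card := by
          gcongr with r
          have h := complexity_mul_le_holds (C (pt (Sum.inl r)) : MvPolynomial (Fin n) ℂ) (Λ r)
          rw [complexity_C_holds] at h
          have h2 : complexity (Λ r) ≤ 3 * n + 1 := complexity_scaledPow_le _
          omega
      _ = 6 * n + 6 := by simp; ring
      _ ≤ n ^ 2 := by nlinarith
  · rw [Sps2Hit.coeff_sum_C_mul, map_mul, eval_C, Sps2Hit.eval_generator₂, Finset.mul_sum]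
    refine Finset.sum_congr rfl fun r _ => ?_
    rw [hΛ, coeff_scaledPow]
    ring

end Sps2Two

open Sps2Two

/-- **`ΣΠΣ(2)` distinguishers are hit by `SmallCircuits ℂ n 2`** (`n ≥ 7`): every nonzero
`a ∏ ℓ_i + b ∏ ℓ'_j` with affine forms `ℓ_i, ℓ'_j` of total degree `1` in the `C(2n,n)` coefficient
variables is nonzero at the coefficient vector of a degree-`≤ n` polynomial of size `≤ n²` (tree:
`SmallCircuits ℂ n 9`, `isSuccinctHittingSet_sps2`). [cite: ForbesShpilkaVolk2018, §3 and Question 6] -/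
theorem isSuccinctHittingSet_sps2_two {n : ℕ} (hn : 7 ≤ n) :
    IsSuccinctHittingSet (degLEMonomials n) (SmallCircuits ℂ n 2)
      {D | ∃ (p q : ℕ) (a b : ℂ) (ℓ : Fin p → MvPolynomial (degLEMonomials n) ℂ)
        (ℓ' : Fin q → MvPolynomial (degLEMonomials n) ℂ),
        (∀ i, (ℓ i).totalDegree = 1) ∧ (∀ j, (ℓ' j).totalDegree = 1) ∧
        D = C a * ∏ i, ℓ i + C b * ∏ j, ℓ' j} := by
  rintro D ⟨p, q, a, b, ℓ, ℓ', hℓ, hℓ', rfl⟩ hD0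
  exact Generator.exists_mem_smallCircuits_of_aeval_ne_zero (realisable_two hn)
    (weighted_not_annihilated a b ℓ ℓ' hℓ hℓ' hD0)

/-- The same for every size exponent `b ≥ 2`. [cite: ForbesShpilkaVolk2018, Question 6] -/
theorem isSuccinctHittingSet_sps2_of_two_le {n b : ℕ} (hn : 7 ≤ n) (hb : 2 ≤ b) :
    IsSuccinctHittingSet (degLEMonomials n) (SmallCircuits ℂ n b)
      {D | ∃ (p q : ℕ) (a b : ℂ) (ℓ : Fin p → MvPolynomial (degLEMonomials n) ℂ)
        (ℓ' : Fin q → MvPolynomial (degLEMonomials n) ℂ),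
        (∀ i, (ℓ i).totalDegree = 1) ∧ (∀ j, (ℓ' j).totalDegree = 1) ∧
        D = C a * ∏ i, ℓ i + C b * ∏ j, ℓ' j} :=
  (isSuccinctHittingSet_sps2_two hn).mono (smallCircuits_mono ℂ hb (by omega)) le_rfl

/-- **No `ΣΠΣ(2)` natural proofs against size `n²`**: for `n ≥ 7`, `b ≥ 2`, any class `𝒟` and any
affine forms of total degree `1`, `a ∏ ℓ_i + b' ∏ ℓ'_j` is NOT an algebraically natural proof against
`SmallCircuits ℂ n b` (tree: `b ≥ 9`). [cite: ForbesShpilkaVolk2018, Def. 1 and Thm. 4] -/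
theorem not_isNaturalProof_sps2_two {n b : ℕ} (hn : 7 ≤ n) (hb : 2 ≤ b)
    (𝒟 : Set (MvPolynomial (degLEMonomials n) ℂ)) {p q : ℕ} (a b' : ℂ)
    (ℓ : Fin p → MvPolynomial (degLEMonomials n) ℂ) (ℓ' : Fin q → MvPolynomial (degLEMonomials n) ℂ)
    (hℓ : ∀ i, (ℓ i).totalDegree = 1) (hℓ' : ∀ j, (ℓ' j).totalDegree = 1) :
    ¬ IsNaturalProof (degLEMonomials n) (SmallCircuits ℂ n b) 𝒟
      (C a * ∏ i, ℓ i + C b' * ∏ j, ℓ' j) := by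
  rintro ⟨-, hD0, hvan⟩
  obtain ⟨f, hf, hne⟩ :=
    isSuccinctHittingSet_sps2_of_two_le hn hb _ ⟨p, q, a, b', ℓ, ℓ', hℓ, hℓ', rfl⟩ hD0
  exact hne (hvan f hf)

/-- **Products of affine forms are hit at exponent 2** (`n ≥ 7`). [cite: ForbesShpilkaVolk2018, Question 6] -/
theorem isSuccinctHittingSet_prodAffine_two {n : ℕ} (hn : 7 ≤ n) :
    IsSuccinctHittingSet (degLEMonomials n) (SmallCircuits ℂ n 2)
      {D | ∃ (p : ℕ) (a : ℂ) (ℓ : Fin p → MvPolynomial (degLEMonomials n) ℂ),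
        (∀ i, (ℓ i).totalDegree = 1) ∧ D = C a * ∏ i, ℓ i} := by
  rintro D ⟨p, a, ℓ, hℓ, rfl⟩ hD0
  refine isSuccinctHittingSet_sps2_two hn _ ⟨p, 0, a, 0, ℓ, Fin.elim0, hℓ, fun j => j.elim0, ?_⟩ hD0
  simp

/-- **`2 × 2` determinants of affine forms are hit at exponent 2** (`n ≥ 7`).
[cite: ForbesShpilkaVolk2018, Question 6] -/
theorem isSuccinctHittingSet_twoByTwoAffine_two {n : ℕ} (hn : 7 ≤ n) :
    IsSuccinctHittingSet (degLEMonomials n) (SmallCircuits ℂ n 2)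
      {D | ∃ ℓ₁ ℓ₂ ℓ₃ ℓ₄ : MvPolynomial (degLEMonomials n) ℂ,
        ℓ₁.totalDegree = 1 ∧ ℓ₂.totalDegree = 1 ∧ ℓ₃.totalDegree = 1 ∧ ℓ₄.totalDegree = 1 ∧
        D = ℓ₁ * ℓ₂ - ℓ₃ * ℓ₄} := by
  rintro D ⟨ℓ₁, ℓ₂, ℓ₃, ℓ₄, h₁, h₂, h₃, h₄, rfl⟩ hD0
  refine isSuccinctHittingSet_sps2_two hn _
    ⟨2, 2, 1, -1, ![ℓ₁, ℓ₂], ![ℓ₃, ℓ₄], ?_, ?_, ?_⟩ hD0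
  · intro i; fin_cases i <;> assumption
  · intro j; fin_cases j <;> assumption
  · simp only [Fin.prod_univ_two, Matrix.cons_val_zero, Matrix.cons_val_one, map_one,
      one_mul, map_neg, neg_mul, Matrix.cons_val_fin_one]
    ring

end Summit.ValiantsHypothesis.ValiantsHypothesis.Theorems.BarrierLever.SuccinctHittingSetsForVP

end
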